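import Summits.AtomisticToContinuum.FouriersLaw.Theorems.LatticeLandauDampingAbelThermodynamicLimitUniformAnchoredCorrelationTailsPairReduction
import Summits.AtomisticToContinuum.FouriersLaw.Theorems.EmbeddedDrudeMourreAbelThermodynamicLimitCentralBondCurrentSecondMoments
import Mathlib.Analysis.PSeries
import Mathlib.Algebra.Order.Field.GeomSum

/-!
# (C′) `stub_uniformAnchoredCorrelationTails` from the `N`-uniform single-flip light cone of the open chain (reduction)

Helper (`--supports stmt-AtomisticToContinuum-14013`) for the line `series-law-at-every-laplace-frequency`
(SketchIdeator2) of the crux `LatticeLandauDamping.AbelThermodynamicLimit`, stub (C′)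
`stub_uniformAnchoredCorrelationTails`. Registered sub-goal `uniformAnchoredCorrelationTails_of_singleFlipLocality`.

(C′) — the light cone of the OPEN pinned chain at fixed time, anchor-uniform: for every horizon `τ` and `ε > 0`
there are a window `R` and `N₀` with `Σ_{k : |k − i| > R} |⟨j_i(0) j_k(t)⟩_{N,T}| ≤ ε` for all `N ≥ N₀`, all
`R`-deep anchors `i` and all `t ∈ [0, τ]` — is derived here from the SINGLE-FLIP LOCALITY statement (SF) (the
hypothesis, VERBATIM the conclusion of the registered helper `pinnedChain_singleFlipLocality`): under the stationary
law `μ_T ⊗ W`, two strong solutions driven by the SAME Brownian pair from `x` and from `x` with ONE momentum `p_{i₀}`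
flipped see bond currents `j_k` differing in mean square by at most `(a r^D + b/D²)²` at every bond `(k, k+1)` at
distance `≥ D ≥ D₀` from `i₀`, with `a, b ≥ 0`, `0 ≤ r < 1`, `D₀` depending on `τ` but NOT on `N`, `i₀`, `k`.

Proof: each far term is `≤ √M · (a r^D + b/D²)` with `D = |k − i| − 1` and `M` the `N`-uniform second moment of the
bond currents (`pinnedChain_sq_pairCorrelation_le_of_singleFlips` at the anchor bond `(i, i+1)`, with the two single
flips at `i+1` and at `i`; `pinnedChain_integral_sq_bondCurrent_gibbsMeasure_le`; the last bond `k = N − 1` carries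
no current); each distance `D ≥ R` is attained by at most two bonds, and `Σ_{D ≥ R} (a r^D + b/D²) ≤ a r^R/(1 − r) +
2b/R → 0`. Real analysis and bookkeeping only; no definitions.
-/

noncomputable section

open MeasureTheory ProbabilityTheory Set Filter Topology Finset
open scoped NNReal ENNReal BigOperators

namespace Summit.AtomisticToContinuum.FouriersLaw.Theorems.AbelThermodynamicLimit.SeriesLawAtEveryLaplaceFrequency

open Literature.MathematicalPhysics.KineticTheory Literature.MathematicalPhysics.KineticTheory.HeatConduction
open Literature.Probability.Process OscillatorChain
open Summit.AtomisticToContinuum.FouriersLaw.Theorems.AbelThermodynamicLimit.LoomisCompactHorizonWitness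
  (pinnedChain_integral_sq_bondCurrent_gibbsMeasure_le)

namespace FlipAssembly

/-! ### Real analysis: the tail sums -/

/-- `Σ_{D ∈ [R, M)} (a r^D + b/D²) ≤ a r^R/(1−r) + 2b/R` for `a, b ≥ 0`, `0 ≤ r < 1`, `R ≥ 1`. [folklore] -/
theorem sum_Ico_rate_le {a b r : ℝ} (ha : 0 ≤ a) (hb : 0 ≤ b) (hr : 0 ≤ r) (hr1 : r < 1) {R : ℕ} (hR : 1 ≤ R)
    (M : ℕ) : ∑ D ∈ Finset.Ico R M, (a * r ^ D + b / (D : ℝ) ^ 2) ≤ a * (r ^ R / (1 - r)) + 2 * b / R := by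
  rw [Finset.sum_add_distrib, ← Finset.mul_sum]
  refine add_le_add (mul_le_mul_of_nonneg_left (geom_sum_Ico_le_of_lt_one hr hr1) ha) ?_
  have h := sum_Ioo_inv_sq_le (α := ℝ) (R - 1) M
  have hI : Finset.Ioo (R - 1) M = Finset.Ico R M := by
    ext i; simp only [Finset.mem_Ioo, Finset.mem_Ico]; omega
  rw [hI, Nat.cast_sub hR, Nat.cast_one, sub_add_cancel] at h
  calc ∑ D ∈ Finset.Ico R M, b / (D : ℝ) ^ 2 = b * ∑ D ∈ Finset.Ico R M, ((D : ℝ) ^ 2)⁻¹ := by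
        rw [Finset.mul_sum]; exact Finset.sum_congr rfl fun D _ => by rw [div_eq_mul_inv]
    _ ≤ b * (2 / R) := mul_le_mul_of_nonneg_left h hb
    _ = 2 * b / R := by ring

/-- The tail bound tends to zero: for every `η > 0` there is `R ≥ R₀` with `a r^R/(1−r) + 2b/R ≤ η`. [folklore] -/
theorem exists_window {a b r : ℝ} (hr : 0 ≤ r) (hr1 : r < 1) {η : ℝ} (hη : 0 < η) (R₀ : ℕ) :
    ∃ R : ℕ, R₀ ≤ R ∧ a * (r ^ R / (1 - r)) + 2 * b / R ≤ η := by
  have h1 : Tendsto (fun R : ℕ => a * (r ^ R / (1 - r))) atTop (𝓝 0) := by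
    have := ((tendsto_pow_atTop_nhds_zero_of_lt_one hr hr1).div_const (1 - r)).const_mul a
    simpa using this
  have h2 : Tendsto (fun R : ℕ => 2 * b / (R : ℝ)) atTop (𝓝 0) := tendsto_const_div_atTop_nhds_zero_nat _
  have h := h1.add h2
  rw [add_zero] at h
  obtain ⟨R, hR1, hR2⟩ := ((h.eventually (Iic_mem_nhds hη)).and (eventually_ge_atTop R₀)).exists
  exact ⟨R, hR2, hR1⟩

/-- **Each distance is attained at most twice**: for `F ≥ 0` on `[R, ∞)`, an anchor `i` and a window `R`,
`Σ_{k : |k−i| > R, k+1 < N} F(|k − i| − 1) ≤ 2 Σ_{D ∈ [R, N)} F(D)`. [folklore] -/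
theorem sum_far_le {N : ℕ} (i : Fin N) (R : ℕ) {F : ℕ → ℝ} (hF : ∀ D, R ≤ D → 0 ≤ F D) :
    ∑ k : Fin N, (if i.val ≤ k.val + R ∧ k.val ≤ i.val + R then (0 : ℝ) else F ((((k : ℕ) : ℤ) - i).natAbs - 1)) ≤
      2 * ∑ D ∈ Finset.Ico R N, F D := by
  have hsplit : ∀ k : Fin N, (if i.val ≤ k.val + R ∧ k.val ≤ i.val + R then (0 : ℝ) else F ((((k : ℕ) : ℤ) - i).natAbs - 1)) =
      (if k.val + R < i.val then F ((((k : ℕ) : ℤ) - i).natAbs - 1) else 0) +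
        (if i.val + R < k.val then F ((((k : ℕ) : ℤ) - i).natAbs - 1) else 0) := by
    intro k
    by_cases h1 : k.val + R < i.val
    · rw [if_neg (by omega), if_pos h1, if_neg (by omega), add_zero]
    · by_cases h2 : i.val + R < k.val
      · rw [if_neg (by omega), if_neg h1, if_pos h2, zero_add]
      · rw [if_pos (by omega), if_neg h1, if_neg h2, add_zero]
  simp_rw [hsplit]
  rw [Finset.sum_add_distrib, ← Finset.sum_filter, ← Finset.sum_filter, two_mul]
  have hsub : ∀ (S : Finset (Fin N)), (∀ k ∈ S, R ≤ (((k : ℕ) : ℤ) - i).natAbs - 1 ∧ (((k : ℕ) : ℤ) - i).natAbs - 1 < N) →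
      Set.InjOn (fun k : Fin N => (((k : ℕ) : ℤ) - i).natAbs - 1) ↑S →
      ∑ k ∈ S, F ((((k : ℕ) : ℤ) - i).natAbs - 1) ≤ ∑ D ∈ Finset.Ico R N, F D := by
    intro S hS hinj
    rw [← Finset.sum_image hinj]
    refine Finset.sum_le_sum_of_subset_of_nonneg ?_ fun D hD _ => hF D (Finset.mem_Ico.1 hD).1
    intro D hD
    simp only [Finset.mem_image] at hD
    obtain ⟨k, hk, rfl⟩ := hD
    exact Finset.mem_Ico.2 (hS k hk)
  refine add_le_add (hsub _ ?_ ?_) (hsub _ ?_ ?_)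
  · intro k hk
    simp only [Finset.mem_filter, Finset.mem_univ, true_and] at hk
    have := i.isLt; omega
  · intro a ha b hb hab
    simp only [Finset.coe_filter, Finset.mem_univ, true_and, Set.mem_setOf_eq] at ha hb
    exact Fin.ext (by simp only at hab; omega)
  · intro k hk
    simp only [Finset.mem_filter, Finset.mem_univ, true_and] at hk
    have := k.isLt; omega
  · intro a ha b hb hab
    simp only [Finset.coe_filter, Finset.mem_univ, true_and, Set.mem_setOf_eq] at ha hb
    exact Fin.ext (by simp only at hab; omega)

/-- `x² ≤ M F²` with `M, F ≥ 0` gives `|x| ≤ √M · F`. [folklore] -/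
theorem abs_le_sqrt_mul {x M F : ℝ} (hM : 0 ≤ M) (hF : 0 ≤ F) (h : x ^ 2 ≤ M * F ^ 2) : |x| ≤ Real.sqrt M * F := by
  rw [← Real.sqrt_sq_eq_abs, show Real.sqrt M * F = Real.sqrt (M * F ^ 2) by
    rw [Real.sqrt_mul hM, Real.sqrt_sq hF]]
  exact Real.sqrt_le_sqrt h

end FlipAssembly

open FlipAssembly in
/-- **(SF) ⟹ (C′)** (`FlipAssembly.of_singleFlipLocality`, the content of the registered helper
`uniformAnchoredCorrelationTails_of_singleFlipLocality` below): stub (C′)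
`stub_uniformAnchoredCorrelationTails` of line `series-law-at-every-laplace-frequency` — the `N`-uniform,
anchor-uniform light cone of the OPEN pinned chain at fixed time, VERBATIM — follows from the single-flip locality
statement (SF) for the synchronous coupling of the constructed Langevin flow (the hypothesis; it is the conclusion of
the registered helper `pinnedChain_singleFlipLocality`): each far space-time correlation `⟨j_i(0)j_k(t)⟩_{N,T}` is at
most `√M (a r^D + b/D²)`, `D = |k − i| − 1` (`pinnedChain_sq_pairCorrelation_le_of_singleFlips` at the anchor bond
`(i, i+1)`, `N`-uniform second moments `M` of the bond currents), each distance is attained by at most two bonds,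
and `Σ_{D ≥ R}(a r^D + b/D²) ≤ a r^R/(1−r) + 2b/R → 0`. [folklore] -/
theorem FlipAssembly.of_singleFlipLocality
    (hSF : ∀ ω₂ lam β γ : ℝ, 0 < ω₂ → 0 < lam → 0 < β → 0 < γ → ∀ T : ℝ, 0 < T → ∀ τ : ℝ, 0 < τ →
      ∃ a b r : ℝ, 0 ≤ a ∧ 0 ≤ b ∧ 0 ≤ r ∧ r < 1 ∧ ∃ D₀ : ℕ, 1 ≤ D₀ ∧
        ∀ (N : ℕ) (i₀ k : Fin N), (k : ℕ) + 1 < N → ∀ D : ℕ, D₀ ≤ D →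
          D ≤ ((k : ℤ) - i₀).natAbs → D ≤ ((k : ℤ) + 1 - i₀).natAbs → ∀ s : NNReal, (s : ℝ) ≤ τ →
            ∫⁻ x, ∫⁻ ω, ENNReal.ofReal
                (((Literature.MathematicalPhysics.KineticTheory.HeatConduction.pinnedChain ω₂ lam β γ).bondCurrent N k
                    ((Literature.MathematicalPhysics.KineticTheory.HeatConduction.pinnedChain ω₂ lam β γ).solMap N T T s
                      (Literature.MathematicalPhysics.KineticTheory.HeatConduction.momentumFlip i₀ x)
                      (Literature.Probability.Process.pairPath ω)) -
                  (Literature.MathematicalPhysics.KineticTheory.HeatConduction.pinnedChain ω₂ lam β γ).bondCurrent N k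
                    ((Literature.MathematicalPhysics.KineticTheory.HeatConduction.pinnedChain ω₂ lam β γ).solMap N T T s
                      x (Literature.Probability.Process.pairPath ω))) ^ 2)
                ∂Literature.Probability.Process.wienerPair
                ∂((Literature.MathematicalPhysics.KineticTheory.HeatConduction.pinnedChain ω₂ lam β γ).gibbsMeasure N T) ≤
              ENNReal.ofReal ((a * r ^ D + b / (D : ℝ) ^ 2) ^ 2)) :
    ∀ ω₂ lam β γ : ℝ, 0 < ω₂ → 0 < lam → 0 < β → 0 < γ → ∀ T : ℝ, 0 < T →
      ∀ τ : ℝ, 0 < τ → ∀ ε : ℝ, 0 < ε → ∃ R N₀ : ℕ, ∀ N : ℕ, N₀ ≤ N → ∀ i : Fin N,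
        R ≤ i.val → i.val + R < N → ∀ t ∈ Set.Icc (0 : ℝ) τ,
          (∑ k : Fin N, if i.val ≤ k.val + R ∧ k.val ≤ i.val + R then (0 : ℝ) else
            |∫ z, (Literature.MathematicalPhysics.KineticTheory.HeatConduction.pinnedChain
                    ω₂ lam β γ).bondCurrent N i z *
                (∫ y, (Literature.MathematicalPhysics.KineticTheory.HeatConduction.pinnedChain
                    ω₂ lam β γ).bondCurrent N k y
                  ∂((Literature.MathematicalPhysics.KineticTheory.HeatConduction.pinnedChain
                    ω₂ lam β γ).transitionKernel N T T t.toNNReal z))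
              ∂((Literature.MathematicalPhysics.KineticTheory.HeatConduction.pinnedChain
                    ω₂ lam β γ).gibbsMeasure N T)|) ≤ ε := by
  intro ω₂ lam β γ hω hl hβ hγ T hT τ hτ ε hε
  set P := pinnedChain ω₂ lam β γ with hP
  obtain ⟨a, b, r, ha, hb, hr, hr1, D₀, hD₀, hSF'⟩ := hSF ω₂ lam β γ hω hl hβ hγ T hT τ hτ
  obtain ⟨M', hM'⟩ := pinnedChain_integral_sq_bondCurrent_gibbsMeasure_le (γ := γ) hω hl hβ hT
  set M : ℝ := max M' 0 with hM
  have hM0 : 0 ≤ M := le_max_right _ _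
  have hMk : ∀ (N : ℕ) (k : Fin N), ∫ z, P.bondCurrent N k z ^ 2 ∂(P.gibbsMeasure N T) ≤ M :=
    fun N k => (hM' N k).trans (le_max_left _ _)
  set F : ℕ → ℝ := fun D => a * r ^ D + b / (D : ℝ) ^ 2 with hF
  have hF0 : ∀ D, 0 ≤ F D := fun D => by simp only [hF]; positivity
  -- the window
  have hη : 0 < ε / (2 * (Real.sqrt M + 1)) := by positivity
  obtain ⟨R, hRD₀, hRη⟩ := exists_window (a := a) (b := b) hr hr1 hη (max D₀ 1)
  have hR1 : 1 ≤ R := le_trans (le_max_right _ _) hRD₀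
  have hRD : D₀ ≤ R := le_trans (le_max_left _ _) hRD₀
  refine ⟨R, 0, fun N _ i hiR hiRN t ht => ?_⟩
  have hN0 : 0 < N := i.pos
  have hi1 : i.val + 1 < N := by omega
  set i' : Fin N := ⟨i.val + 1, hi1⟩ with hi'
  set s : ℝ≥0 := t.toNNReal with hs
  have hst : (s : ℝ) ≤ τ := by rw [hs, Real.coe_toNNReal _ ht.1]; exact ht.2
  -- each term
  have hterm : ∀ k : Fin N, (if i.val ≤ k.val + R ∧ k.val ≤ i.val + R then (0 : ℝ) else
      |∫ z, P.bondCurrent N i z * (∫ y, P.bondCurrent N k y ∂(P.transitionKernel N T T s z)) ∂(P.gibbsMeasure N T)|) ≤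
      (if i.val ≤ k.val + R ∧ k.val ≤ i.val + R then (0 : ℝ) else
        Real.sqrt M * F ((((k : ℕ) : ℤ) - i).natAbs - 1)) := by
    intro k
    split_ifs with hcond
    · exact le_rfl
    · by_cases hkN : k.val + 1 < N
      · -- a genuine far bond: the two single flips at distance `D = |k - i| - 1 ≥ R ≥ D₀`
        set D : ℕ := (((k : ℕ) : ℤ) - i).natAbs - 1 with hD
        have hfar : k.val + R < i.val ∨ i.val + R < k.val := by omega
        have hRD' : R ≤ D := by rw [hD]; rcases hfar with h | h <;> omega
        have hDD₀ : D₀ ≤ D := hRD.trans hRD'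
        have h₁ := hSF' N i' k hkN D hDD₀ (by rw [hD, hi']; push_cast; rcases hfar with h | h <;> omega)
          (by rw [hD, hi']; push_cast; rcases hfar with h | h <;> omega) s hst
        have h₂ := hSF' N i k hkN D hDD₀ (by rw [hD]; omega) (by rw [hD]; rcases hfar with h | h <;> omega) s hst
        have hsq := pinnedChain_sq_pairCorrelation_le_of_singleFlips ω₂ lam β γ hω hl hβ hγ T hT N i i' k rfl s
          ((F D) ^ 2) ((F D) ^ 2) (sq_nonneg _) (sq_nonneg _) h₁ h₂
        refine abs_le_sqrt_mul hM0 (hF0 D) (hsq.trans ?_)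
        have := hMk N i
        nlinarith [sq_nonneg (F D)]
      · -- the last bond carries no current
        have hk : k.val + 1 = N := by omega
        have h0 : ∀ y, P.bondCurrent N k y = 0 := fun y => P.bondCurrent_eq_zero_of_last N k hk y
        simp only [h0, integral_zero, mul_zero, abs_zero]
        exact mul_nonneg (Real.sqrt_nonneg _) (hF0 _)
  -- sum
  calc (∑ k : Fin N, if i.val ≤ k.val + R ∧ k.val ≤ i.val + R then (0 : ℝ) else
        |∫ z, P.bondCurrent N i z * (∫ y, P.bondCurrent N k y ∂(P.transitionKernel N T T s z)) ∂(P.gibbsMeasure N T)|)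
      ≤ ∑ k : Fin N, (if i.val ≤ k.val + R ∧ k.val ≤ i.val + R then (0 : ℝ) else
          Real.sqrt M * F ((((k : ℕ) : ℤ) - i).natAbs - 1)) := Finset.sum_le_sum fun k _ => hterm k
    _ = Real.sqrt M * ∑ k : Fin N, (if i.val ≤ k.val + R ∧ k.val ≤ i.val + R then (0 : ℝ) else
          F ((((k : ℕ) : ℤ) - i).natAbs - 1)) := by
        rw [Finset.mul_sum]
        refine Finset.sum_congr rfl fun k _ => ?_
        split_ifs <;> simp
    _ ≤ Real.sqrt M * (2 * ∑ D ∈ Finset.Ico R N, F D) :=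
        mul_le_mul_of_nonneg_left (sum_far_le i R fun D _ => hF0 D) (Real.sqrt_nonneg _)
    _ ≤ Real.sqrt M * (2 * (a * (r ^ R / (1 - r)) + 2 * b / R)) :=
        mul_le_mul_of_nonneg_left (mul_le_mul_of_nonneg_left (sum_Ico_rate_le ha hb hr hr1 hR1 N) (by norm_num))
          (Real.sqrt_nonneg _)
    _ ≤ Real.sqrt M * (2 * (ε / (2 * (Real.sqrt M + 1)))) :=
        mul_le_mul_of_nonneg_left (mul_le_mul_of_nonneg_left hRη (by norm_num)) (Real.sqrt_nonneg _)
    _ = ε * (Real.sqrt M / (Real.sqrt M + 1)) := by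
        have hpos : 0 < Real.sqrt M + 1 := by positivity
        field_simp
    _ ≤ ε * 1 := by
        refine mul_le_mul_of_nonneg_left ?_ hε.le
        rw [div_le_one (by positivity)]
        linarith
    _ = ε := mul_one ε

/-- **Registered helper `uniformAnchoredCorrelationTails_of_singleFlipLocality`** — the registered text VERBATIM:
(SF) ⟹ (C′) (`FlipAssembly.of_singleFlipLocality`). [folklore] -/
theorem uniformAnchoredCorrelationTails_of_singleFlipLocality :
    (∀ ω₂ lam β γ : ℝ, 0 < ω₂ → 0 < lam → 0 < β → 0 < γ → ∀ T : ℝ, 0 < T → ∀ τ : ℝ, 0 < τ →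
          ∃ a b r : ℝ, 0 ≤ a ∧ 0 ≤ b ∧ 0 ≤ r ∧ r < 1 ∧ ∃ D₀ : ℕ, 1 ≤ D₀ ∧
            ∀ (N : ℕ) (i₀ k : Fin N), (k : ℕ) + 1 < N → ∀ D : ℕ, D₀ ≤ D →
              D ≤ ((k : ℤ) - i₀).natAbs → D ≤ ((k : ℤ) + 1 - i₀).natAbs → ∀ s : NNReal, (s : ℝ) ≤ τ →
                ∫⁻ x, ∫⁻ ω, ENNReal.ofReal
                    (((Literature.MathematicalPhysics.KineticTheory.HeatConduction.pinnedChain ω₂ lam β γ).bondCurrent N k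
                        ((Literature.MathematicalPhysics.KineticTheory.HeatConduction.pinnedChain ω₂ lam β γ).solMap N T T s
                          (Literature.MathematicalPhysics.KineticTheory.HeatConduction.momentumFlip i₀ x)
                          (Literature.Probability.Process.pairPath ω)) -
                      (Literature.MathematicalPhysics.KineticTheory.HeatConduction.pinnedChain ω₂ lam β γ).bondCurrent N k
                        ((Literature.MathematicalPhysics.KineticTheory.HeatConduction.pinnedChain ω₂ lam β γ).solMap N T T s
                          x (Literature.Probability.Process.pairPath ω))) ^ 2)
                    ∂Literature.Probability.Process.wienerPair
                    ∂((Literature.MathematicalPhysics.KineticTheory.HeatConduction.pinnedChain ω₂ lam β γ).gibbsMeasure N T) ≤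
                  ENNReal.ofReal ((a * r ^ D + b / (D : ℝ) ^ 2) ^ 2)) →
    ∀ ω₂ lam β γ : ℝ, 0 < ω₂ → 0 < lam → 0 < β → 0 < γ → ∀ T : ℝ, 0 < T →
          ∀ τ : ℝ, 0 < τ → ∀ ε : ℝ, 0 < ε → ∃ R N₀ : ℕ, ∀ N : ℕ, N₀ ≤ N → ∀ i : Fin N,
            R ≤ i.val → i.val + R < N → ∀ t ∈ Set.Icc (0 : ℝ) τ,
              (∑ k : Fin N, if i.val ≤ k.val + R ∧ k.val ≤ i.val + R then (0 : ℝ) else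
                |∫ z, (Literature.MathematicalPhysics.KineticTheory.HeatConduction.pinnedChain
                        ω₂ lam β γ).bondCurrent N i z *
                    (∫ y, (Literature.MathematicalPhysics.KineticTheory.HeatConduction.pinnedChain
                        ω₂ lam β γ).bondCurrent N k y
                      ∂((Literature.MathematicalPhysics.KineticTheory.HeatConduction.pinnedChain
                        ω₂ lam β γ).transitionKernel N T T t.toNNReal z))
                  ∂((Literature.MathematicalPhysics.KineticTheory.HeatConduction.pinnedChain
                        ω₂ lam β γ).gibbsMeasure N T)|) ≤ ε :=
  fun hSF => FlipAssembly.of_singleFlipLocality hSF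

end Summit.AtomisticToContinuum.FouriersLaw.Theorems.AbelThermodynamicLimit.SeriesLawAtEveryLaplaceFrequency

end
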